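import Summits.NavierStokesRegularity.NavierStokesRegularity.Theorems.ExtremiserTransiencePerFlowLockedTimesLogDensity
import Summits.NavierStokesRegularity.NavierStokesRegularity.Theorems.ExtremiserTransienceTransienceExitDefs
import Mathlib.Analysis.SpecialFunctions.Integrals.Basic
import HarnessLib

/-!
# Route `ExtremiserTransience`, crux `NearExtremalTransiencePerFlow` (stmt-NavierStokesRegularity-26567),
# LINE g12-α `transience_exit` (ns-idea-5 g12): W `ViolatorWindows` PROVED

`--supports stmt-NavierStokesRegularity-26567 --as helper`.  This file proves, BY NAME over the texts of record
`Theorems/ExtremiserTransienceTransienceExitDefs.lean` (p718677), the flow-side stub W of the registered skeleton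
`Cruxes/NearExtremalTransiencePerFlow/Lines/transience_exit.lean` (0e87ffb200ce):

* `violatorWindows_holds : ViolatorWindows` — a violator (`ZoneTransversality.IsViolator`) carries the canonical measurable
  coefficient `k ∈ [0,1]` with its strict-efficiency read-back, constants `Θ, G, H, c_w, c_lo ≤ c_hi, d > 0`, and for every level
  `κ⋆/2 ≤ m < κ⋆`, every `η > 0` and every `L` a late window `[t₁,t]` of log-length `≥ L` on which the inefficient set `{k ≤ m}` has
  log-mass `≤ η·log-length` and a measurable set `S ⊆ [t₁,t]` of locked `m`-efficient times of log-mass `≥ d·log-length`, each point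
  of which carries the X-ready height package (heights `≤ M`, strict `m`-efficiency at `M`, lock `Z ≤ Θ(ν/M)²P`, gradient `≤ GM²/ν`,
  `c_lo ν ≤ M²(T−τ) ≤ c_hi ν`, `τ + c_w ν/M² < T`, heights `≤ HM` on `[τ, τ + c_w ν/M²]`).

MECHANISM (bookkeeping over landed theorems, no new mathematics).  `PerFlow.efficientTimes_logDensity_of_not_perFlow` gives `k`, the
read-back and, for every `m < κ⋆`, `δ < 1`, `B` and onset, a window on which the `m`-efficient times weigh `> δ·ℓ + B`;
`PerFlow.lockedTimes_logDensity` gives a locked set `S₀` of log-mass `≥ d₀ℓ − c` on every window from a fixed onset; with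
`δ = 1 − min(η, d₀/2)` and `B = min(η,d₀/2)·L⁺ + c⁺ + 1` the set `S = S₀ ∩ {m < k} ∩ [t₁,t]` weighs `≥ (d₀/2)ℓ` (§1, interval-integral
bookkeeping).  At each point of `S` the SUPREMUM height `M = sup|u(τ)|` carries the package (§2 `vw_heightPackage`): strict efficiency
transfers down from the read-back bound `M' ≥ M`; Leray's lower rate (`PerFlow.lerayLowerRate_of_not_extends`) and the Type-I rate give
`c₀²ν ≤ M²(T−τ) ≤ C²ν`, whence the lock `Z ≤ c₂ν(T−τ)P ≤ max(c₂,1)C²(ν/M)²P`, the gradient bound from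
`PerFlow.gradTypeIRate_of_typeIRate` (`(T−τ)|∇u| ≤ C₁` ⇒ `|∇u| ≤ (C₁/c₀²)M²/ν`), the window `c_w = c₀²/2` and the heights `≤ (2C/c₀)M` on it.
Constants: `Θ = max(c₂,1)C²`, `G = C₁/c₀²`, `H = 2C/c₀`, `c_w = c₀²/2`, `c_lo = c₀²`, `c_hi = C²`, `d = d₀/2`.

HONEST FRAMING: W is the bookkeeping stub of the line; the heart X `NearExtremalExit`, the crux ⟨26567⟩ and NS regularity are OPEN;
nothing about Navier–Stokes regularity or blow-up is proved here; no summit is proved by a line. [folklore]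
-/

noncomputable section

open scoped Topology InnerProductSpace RealInnerProductSpace ENNReal ContDiff
open MeasureTheory Filter Set Metric
open Literature.Analysis.FluidPDE
open Summit.NavierStokesRegularity.NavierStokesRegularity.Theorems.DepletionLadder.KStar.HalfSpace
open Summit.NavierStokesRegularity.NavierStokesRegularity.Theorems.NearExtremalTransiencePerFlow.ZoneTransversality

namespace Summit.NavierStokesRegularity.NavierStokesRegularity.Theorems.NearExtremalTransiencePerFlow.TransienceExit

-- the summit's namespace repeats the problem name by convention (D-0017)
set_option linter.dupNamespace false
set_option linter.style.longLine false

/-! ## §1 Log-mass bookkeeping on a window `[t₁, t] ⊂ [0, T)` -/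

/-- `∫_{t₁}^{t} dτ/(T−τ) = log((T−t₁)/(T−t))`. -/
theorem vw_integral_inv_sub {t₁ t T : ℝ} (h1 : t₁ ≤ t) (ht : t < T) :
    (∫ τ in t₁..t, (T - τ)⁻¹) = Real.log ((T - t₁) / (T - t)) := by
  rw [intervalIntegral.integral_comp_sub_left (fun x : ℝ => x⁻¹) T, integral_inv_of_pos (by linarith) (by linarith)]

/-- `(T−τ)⁻¹` is interval-integrable on `[t₁,t]`, `t < T`. -/
theorem vw_intervalIntegrable_inv_sub {t₁ t T : ℝ} (h1 : t₁ ≤ t) (ht : t < T) :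
    IntervalIntegrable (fun τ : ℝ => (T - τ)⁻¹) volume t₁ t := by
  refine intervalIntegral.intervalIntegrable_inv (fun τ hτ => ?_) (continuousOn_const.sub continuousOn_id)
  rw [Set.uIcc_of_le h1] at hτ
  exact (sub_pos.2 (lt_of_le_of_lt hτ.2 ht)).ne'

/-- The log-mass of any measurable set on `[t₁,t]` is at most the log-length. -/
theorem vw_mass_le_log {t₁ t T : ℝ} {A : Set ℝ} (hA : MeasurableSet A) (h1 : t₁ ≤ t) (ht : t < T) :
    (∫ τ in t₁..t, A.indicator (fun _ => (1 : ℝ)) τ / (T - τ)) ≤ Real.log ((T - t₁) / (T - t)) := by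
  rw [← vw_integral_inv_sub h1 ht]
  refine intervalIntegral.integral_mono_on h1 (DepletionLadder.PerFlow.intervalIntegrable_indicator_div hA h1 ht)
    (vw_intervalIntegrable_inv_sub h1 ht) fun τ hτ => ?_
  have hTτ : 0 < T - τ := sub_pos.2 (lt_of_le_of_lt hτ.2 ht)
  by_cases h : τ ∈ A
  · rw [Set.indicator_of_mem h, one_div]
  · rw [Set.indicator_of_notMem h, zero_div]; exact inv_nonneg.2 hTτ.le

/-- Complementary level sets: `∫ 1_{k ≤ m}/(T−τ) = log-length − ∫ 1_{m < k}/(T−τ)`. -/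
theorem vw_compl_mass_eq {t₁ t T m : ℝ} {k : ℝ → ℝ} (hk : Measurable k) (h1 : t₁ ≤ t) (ht : t < T) :
    (∫ τ in t₁..t, Set.indicator {σ : ℝ | k σ ≤ m} (fun _ => (1 : ℝ)) τ / (T - τ)) =
      Real.log ((T - t₁) / (T - t)) - ∫ τ in t₁..t, Set.indicator {σ : ℝ | m < k σ} (fun _ => (1 : ℝ)) τ / (T - τ) := by
  have e : (fun τ => Set.indicator {σ : ℝ | k σ ≤ m} (fun _ => (1 : ℝ)) τ / (T - τ)) =
      fun τ => (T - τ)⁻¹ - Set.indicator {σ : ℝ | m < k σ} (fun _ => (1 : ℝ)) τ / (T - τ) := by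
    funext τ
    by_cases h : k τ ≤ m
    · have h' : τ ∉ {σ : ℝ | m < k σ} := fun h'' => absurd h (not_le.2 h'')
      rw [Set.indicator_of_mem (show τ ∈ {σ : ℝ | k σ ≤ m} from h), Set.indicator_of_notMem h', zero_div, sub_zero, one_div]
    · have h' : τ ∈ {σ : ℝ | m < k σ} := not_le.1 h
      rw [Set.indicator_of_notMem (show τ ∉ {σ : ℝ | k σ ≤ m} from h), Set.indicator_of_mem h', zero_div, one_div, sub_self]
  rw [e, intervalIntegral.integral_sub (vw_intervalIntegrable_inv_sub h1 ht)
    (DepletionLadder.PerFlow.intervalIntegrable_indicator_div (measurableSet_lt measurable_const hk) h1 ht),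
    vw_integral_inv_sub h1 ht]

/-- Intersecting with the efficient set costs at most the inefficient log-mass. -/
theorem vw_inter_mass_ge {t₁ t T m : ℝ} {k : ℝ → ℝ} {S₀ : Set ℝ} (hS₀ : MeasurableSet S₀) (hk : Measurable k)
    (h1 : t₁ ≤ t) (ht : t < T) :
    (∫ τ in t₁..t, S₀.indicator (fun _ => (1 : ℝ)) τ / (T - τ)) -
        (∫ τ in t₁..t, Set.indicator {σ : ℝ | k σ ≤ m} (fun _ => (1 : ℝ)) τ / (T - τ)) ≤
      ∫ τ in t₁..t, (S₀ ∩ {σ : ℝ | m < k σ} ∩ Set.Icc t₁ t).indicator (fun _ => (1 : ℝ)) τ / (T - τ) := by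
  have hFm : MeasurableSet {σ : ℝ | k σ ≤ m} := measurableSet_le hk measurable_const
  have hSm : MeasurableSet (S₀ ∩ {σ : ℝ | m < k σ} ∩ Set.Icc t₁ t) :=
    (hS₀.inter (measurableSet_lt measurable_const hk)).inter measurableSet_Icc
  rw [← intervalIntegral.integral_sub (DepletionLadder.PerFlow.intervalIntegrable_indicator_div hS₀ h1 ht)
    (DepletionLadder.PerFlow.intervalIntegrable_indicator_div hFm h1 ht)]
  refine intervalIntegral.integral_mono_on h1
    ((DepletionLadder.PerFlow.intervalIntegrable_indicator_div hS₀ h1 ht).sub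
      (DepletionLadder.PerFlow.intervalIntegrable_indicator_div hFm h1 ht))
    (DepletionLadder.PerFlow.intervalIntegrable_indicator_div hSm h1 ht) fun τ hτ => ?_
  have hTτ : 0 < T - τ := sub_pos.2 (lt_of_le_of_lt hτ.2 ht)
  have hi0 : 0 ≤ (T - τ)⁻¹ := inv_nonneg.2 hTτ.le
  by_cases hS : τ ∈ S₀
  · by_cases hF : k τ ≤ m
    · rw [Set.indicator_of_mem hS, Set.indicator_of_mem (show τ ∈ {σ : ℝ | k σ ≤ m} from hF), sub_self]
      exact div_nonneg (Set.indicator_nonneg (fun _ _ => zero_le_one) _) hTτ.le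
    · have hmem : τ ∈ S₀ ∩ {σ : ℝ | m < k σ} ∩ Set.Icc t₁ t := ⟨⟨hS, not_le.1 hF⟩, hτ⟩
      rw [Set.indicator_of_mem hS, Set.indicator_of_notMem (show τ ∉ {σ : ℝ | k σ ≤ m} from hF),
        Set.indicator_of_mem hmem, zero_div, sub_zero]
  · rw [Set.indicator_of_notMem hS, zero_div, zero_sub]
    exact (neg_nonpos.2 (div_nonneg (Set.indicator_nonneg (fun _ _ => zero_le_one) _) hTτ.le)).trans
      (div_nonneg (Set.indicator_nonneg (fun _ _ => zero_le_one) _) hTτ.le)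

/-! ## §2 The height package at a late, locked, efficient time -/

/-- **The X-ready height package.**  At a time `τ < T` where the Type-I rate holds on `[τ,T)`, the gradient rate and
Leray's lower rate hold, the slice is locked (`Z ≤ c₂ν(T−τ)P`) and strictly `m`-efficient at some height bound, the
SUPREMUM height `M = sup|u(τ)|` carries the whole package with the constants
`Θ = max c₂ 1·C²`, `G = C₁/c₀²`, `H = 2C/c₀`, `c_w = c₀²/2`, `c_lo = c₀²`, `c_hi = C²`. -/
theorem vw_heightPackage {C c₀ C₁ c₂ ν T τ m : ℝ} {u : ℝ → EuclideanSpace ℝ (Fin 3) → EuclideanSpace ℝ (Fin 3)}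
    (hν : 0 < ν) (hC : 0 < C) (hc₀ : 0 < c₀) (hτT : τ < T)
    (hTI : ∀ t' ∈ Set.Ico τ T, ∀ x, Real.sqrt (T - t') * ‖u t' x‖ ≤ C * Real.sqrt ν)
    (hgr : ∀ x, (T - τ) * ‖fderiv ℝ (u τ) x‖ ≤ C₁)
    (hler : ∃ x, c₀ * Real.sqrt ν ≤ Real.sqrt (T - τ) * ‖u τ x‖)
    (hlock : (∫ x, ‖curl (u τ) x‖ ^ 2) ≤ c₂ * (ν * (T - τ)) * (∫ x, frobeniusNormSq (fderiv ℝ (curl (u τ)) x)))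
    (hm0 : 0 ≤ m)
    (hread : ∃ M' : ℝ, (∀ x, ‖u τ x‖ ≤ M') ∧
      m * M' * Real.sqrt (∫ x, ‖curl (u τ) x‖ ^ 2) * Real.sqrt (∫ x, frobeniusNormSq (fderiv ℝ (curl (u τ)) x)) <
        |∫ x, ⟪curl (u τ) x, fderiv ℝ (u τ) x (curl (u τ) x)⟫_ℝ|) :
    ∃ M : ℝ, 0 < M ∧ (∀ x, ‖u τ x‖ ≤ M) ∧
      m * M * Real.sqrt (∫ x, ‖curl (u τ) x‖ ^ 2) * Real.sqrt (∫ x, frobeniusNormSq (fderiv ℝ (curl (u τ)) x)) <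
        |∫ x, ⟪curl (u τ) x, fderiv ℝ (u τ) x (curl (u τ) x)⟫_ℝ| ∧
      (∫ x, ‖curl (u τ) x‖ ^ 2) ≤ (max c₂ 1 * C ^ 2) * (ν / M) ^ 2 * (∫ x, frobeniusNormSq (fderiv ℝ (curl (u τ)) x)) ∧
      (∀ x, ‖fderiv ℝ (u τ) x‖ ≤ C₁ / c₀ ^ 2 * M ^ 2 / ν) ∧
      c₀ ^ 2 * ν ≤ M ^ 2 * (T - τ) ∧ M ^ 2 * (T - τ) ≤ C ^ 2 * ν ∧
      τ + c₀ ^ 2 / 2 * ν / M ^ 2 < T ∧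
      (∀ t' ∈ Set.Icc τ (τ + c₀ ^ 2 / 2 * ν / M ^ 2), ∀ x, ‖u t' x‖ ≤ 2 * C / c₀ * M) := by
  have hTτ : 0 < T - τ := sub_pos.2 hτT
  have hsq : 0 < Real.sqrt (T - τ) := Real.sqrt_pos.2 hTτ
  have hsν : 0 < Real.sqrt ν := Real.sqrt_pos.2 hν
  set Z : ℝ := ∫ x, ‖curl (u τ) x‖ ^ 2 with hZ
  set P : ℝ := ∫ x, frobeniusNormSq (fderiv ℝ (curl (u τ)) x) with hP
  have hP0 : 0 ≤ P := integral_nonneg fun x => frobeniusNormSq_nonneg _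
  -- Type-I at `τ`: `|u(τ,x)| ≤ C√ν/√(T−τ)`
  have hTIτ : ∀ x, ‖u τ x‖ ≤ C * Real.sqrt ν / Real.sqrt (T - τ) := fun x => by
    rw [le_div_iff₀ hsq, mul_comm]; exact hTI τ ⟨le_rfl, hτT⟩ x
  have hbdd : BddAbove (Set.range fun x => ‖u τ x‖) := ⟨_, by rintro _ ⟨x, rfl⟩; exact hTIτ x⟩
  set M : ℝ := ⨆ x, ‖u τ x‖ with hM
  have hle : ∀ x, ‖u τ x‖ ≤ M := fun x => le_ciSup hbdd x
  have hMle : ∀ M' : ℝ, (∀ x, ‖u τ x‖ ≤ M') → M ≤ M' := fun M' h => ciSup_le h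
  have hMTI : M ≤ C * Real.sqrt ν / Real.sqrt (T - τ) := hMle _ hTIτ
  -- Leray from below: `c₀√ν ≤ √(T−τ)·M`, hence `M > 0` and `c₀²ν ≤ M²(T−τ)`
  obtain ⟨x₀, hx₀⟩ := hler
  have hlow : c₀ * Real.sqrt ν ≤ Real.sqrt (T - τ) * M :=
    hx₀.trans (mul_le_mul_of_nonneg_left (hle x₀) hsq.le)
  have hMpos : 0 < M := by
    by_contra hM0
    push Not at hM0
    have h1 : 0 < c₀ * Real.sqrt ν := mul_pos hc₀ hsν
    have h2 : Real.sqrt (T - τ) * M ≤ 0 := mul_nonpos_of_nonneg_of_nonpos hsq.le hM0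
    linarith
  have hM2 : 0 < M ^ 2 := by positivity
  have hlo : c₀ ^ 2 * ν ≤ M ^ 2 * (T - τ) := by
    have h := pow_le_pow_left₀ (mul_pos hc₀ hsν).le hlow 2
    rw [mul_pow, mul_pow, Real.sq_sqrt hν.le, Real.sq_sqrt hTτ.le] at h
    linarith
  have hhi : M ^ 2 * (T - τ) ≤ C ^ 2 * ν := by
    have h1 : M * Real.sqrt (T - τ) ≤ C * Real.sqrt ν := (le_div_iff₀ hsq).1 hMTI
    have h := pow_le_pow_left₀ (mul_nonneg hMpos.le hsq.le) h1 2
    rw [mul_pow, mul_pow, Real.sq_sqrt hν.le, Real.sq_sqrt hTτ.le] at h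
    exact h
  refine ⟨M, hMpos, hle, ?_, ?_, ?_, hlo, hhi, ?_, ?_⟩
  · -- strict `m`-efficiency transfers DOWN to the smaller height bound `M ≤ M'`
    obtain ⟨M', hM', hstr⟩ := hread
    have hMM' : M ≤ M' := hMle M' hM'
    have h1 : m * M * Real.sqrt Z * Real.sqrt P ≤ m * M' * Real.sqrt Z * Real.sqrt P :=
      mul_le_mul_of_nonneg_right (mul_le_mul_of_nonneg_right (mul_le_mul_of_nonneg_left hMM' hm0)
        (Real.sqrt_nonneg _)) (Real.sqrt_nonneg _)
    exact lt_of_le_of_lt h1 hstr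
  · -- lock: `Z ≤ c₂ν(T−τ)P ≤ max(c₂,1)·C²(ν/M)²·P` since `ν(T−τ) ≤ C²ν²/M²`
    have hνT : ν * (T - τ) ≤ C ^ 2 * (ν / M) ^ 2 := by
      rw [div_pow, ← mul_div_assoc, le_div_iff₀ hM2]
      nlinarith [hhi, hν]
    have h1 : c₂ * (ν * (T - τ)) * P ≤ max c₂ 1 * (ν * (T - τ)) * P :=
      mul_le_mul_of_nonneg_right (mul_le_mul_of_nonneg_right (le_max_left _ _) (by positivity)) hP0
    have h2 : max c₂ 1 * (ν * (T - τ)) * P ≤ max c₂ 1 * (C ^ 2 * (ν / M) ^ 2) * P :=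
      mul_le_mul_of_nonneg_right (mul_le_mul_of_nonneg_left hνT (le_trans zero_le_one (le_max_right _ _))) hP0
    calc Z ≤ c₂ * (ν * (T - τ)) * P := hlock
      _ ≤ max c₂ 1 * (C ^ 2 * (ν / M) ^ 2) * P := h1.trans h2
      _ = max c₂ 1 * C ^ 2 * (ν / M) ^ 2 * P := by ring
  · -- gradient: `(T−τ)|∇u| ≤ C₁` and `c₀²ν ≤ M²(T−τ)`
    intro x
    have hg := hgr x
    have hn : 0 ≤ ‖fderiv ℝ (u τ) x‖ := norm_nonneg _
    rw [show C₁ / c₀ ^ 2 * M ^ 2 / ν = C₁ * M ^ 2 / (c₀ ^ 2 * ν) by field_simp, le_div_iff₀ (by positivity)]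
    calc ‖fderiv ℝ (u τ) x‖ * (c₀ ^ 2 * ν) ≤ ‖fderiv ℝ (u τ) x‖ * (M ^ 2 * (T - τ)) :=
          mul_le_mul_of_nonneg_left hlo hn
      _ = (T - τ) * ‖fderiv ℝ (u τ) x‖ * M ^ 2 := by ring
      _ ≤ C₁ * M ^ 2 := mul_le_mul_of_nonneg_right hg hM2.le
  · -- the forward window fits: `c₀²ν/(2M²) ≤ (T−τ)/2`
    have h1 : c₀ ^ 2 / 2 * ν / M ^ 2 ≤ (T - τ) / 2 := by
      rw [div_le_iff₀ hM2]; nlinarith [hlo]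
    linarith
  · -- heights on the window: `T − t' ≥ (T−τ)/2`, Type-I at `t'`, Leray at `τ`
    intro t' ht' x
    have h1 : c₀ ^ 2 / 2 * ν / M ^ 2 ≤ (T - τ) / 2 := by
      rw [div_le_iff₀ hM2]; nlinarith [hlo]
    have ht'T : t' < T := by linarith [ht'.2]
    have hTt' : (T - τ) ≤ 4 * (T - t') := by linarith [ht'.2]
    have hsq' : Real.sqrt (T - τ) ≤ 2 * Real.sqrt (T - t') := by
      have h4 : Real.sqrt (4 * (T - t')) = 2 * Real.sqrt (T - t') := by
        rw [Real.sqrt_mul (by norm_num) (T - t'), show (4 : ℝ) = 2 ^ 2 by norm_num, Real.sqrt_sq (by norm_num)]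
      rw [← h4]
      exact Real.sqrt_le_sqrt hTt'
    have hti := hTI t' ⟨ht'.1, ht'T⟩ x
    have hn : 0 ≤ ‖u t' x‖ := norm_nonneg _
    -- `|u(t',x)|·√(T−τ) ≤ 2C√ν ≤ (2C/c₀)·M·√(T−τ)`
    have h2 : ‖u t' x‖ * Real.sqrt (T - τ) ≤ 2 * C * Real.sqrt ν := by
      calc ‖u t' x‖ * Real.sqrt (T - τ) ≤ ‖u t' x‖ * (2 * Real.sqrt (T - t')) := mul_le_mul_of_nonneg_left hsq' hn
        _ = 2 * (Real.sqrt (T - t') * ‖u t' x‖) := by ring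
        _ ≤ 2 * (C * Real.sqrt ν) := by linarith [hti]
        _ = 2 * C * Real.sqrt ν := by ring
    have h3 : 2 * C * Real.sqrt ν ≤ 2 * C / c₀ * M * Real.sqrt (T - τ) := by
      rw [show 2 * C / c₀ * M * Real.sqrt (T - τ) = 2 * C * (Real.sqrt (T - τ) * M) / c₀ by ring, le_div_iff₀ hc₀]
      calc 2 * C * Real.sqrt ν * c₀ = 2 * C * (c₀ * Real.sqrt ν) := by ring
        _ ≤ 2 * C * (Real.sqrt (T - τ) * M) := mul_le_mul_of_nonneg_left hlow (by positivity)
    exact le_of_mul_le_mul_right (h2.trans h3) hsq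

/-! ## §3 W: the violator windows -/

/-- **W `ViolatorWindows`** (flow side of LINE g12-α).  For a violator: the canonical coefficient `k` with its strict-efficiency
read-back and the full upper log-density of `m`-efficient times (`PerFlow.efficientTimes_logDensity_of_not_perFlow`), the locked
set of lower log-density `d₀` (`PerFlow.lockedTimes_logDensity`), Leray's lower rate (`PerFlow.lerayLowerRate_of_not_extends`),
the Type-I rate and its gradient form (`PerFlow.gradTypeIRate_of_typeIRate`); on a window where the efficient times have density
`≥ 1 − min(η, d₀/2)` the locked efficient times have density `≥ d₀/2`, and each carries the height package of `vw_heightPackage`. -/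
theorem violatorWindows_holds : ViolatorWindows := by
  intro C ν T u p hV
  obtain ⟨hC, hν, hT, hsol, hLH, hdec, hrate, hext, hno⟩ := hV
  obtain ⟨k, hkm, hk01, -, -, hread, hdens⟩ :=
    DepletionLadder.PerFlow.efficientTimes_logDensity_of_not_perFlow hν hT hsol hLH hdec hno
  obtain ⟨c₂, d₀, hd₀, hlock⟩ := DepletionLadder.PerFlow.lockedTimes_logDensity hC hν hT hsol hLH hdec hrate hext
  obtain ⟨c₀, hc₀, hler⟩ := DepletionLadder.PerFlow.lerayLowerRate_of_not_extends hν hT hsol hLH hdec hext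
  obtain ⟨C₁, hC₁, hgrad⟩ := DepletionLadder.PerFlow.gradTypeIRate_of_typeIRate hC hν hT hsol hLH hdec hrate
  obtain ⟨a, haT, hsub⟩ := mem_nhdsLT_iff_exists_Ioo_subset.1 (hrate.and hgrad)
  have haT' : a < T := haT
  -- the onset `t⋆ = max 0 ((a+T)/2)`: every later time obeys the Type-I and gradient rates
  obtain ⟨ts, hts⟩ : ∃ ts : ℝ, ts = max 0 ((a + T) / 2) := ⟨_, rfl⟩
  have hts0 : 0 ≤ ts := by rw [hts]; exact le_max_left _ _
  have htsT : ts < T := by rw [hts]; exact max_lt hT (by linarith)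
  have htsa : a < ts := by
    rw [hts]; exact lt_of_lt_of_le (by linarith : a < (a + T) / 2) (le_max_right _ _)
  have hlate : ∀ τ, ts ≤ τ → τ < T →
      (∀ x, Real.sqrt (T - τ) * ‖u τ x‖ ≤ C * Real.sqrt ν) ∧ (∀ x, (T - τ) * ‖fderiv ℝ (u τ) x‖ ≤ C₁) :=
    fun τ h1 h2 => hsub ⟨lt_of_lt_of_le htsa h1, h2⟩
  obtain ⟨S₀, hS₀m, hS₀sub, cL, hS₀d⟩ := hlock ts ⟨hts0, htsT⟩
  -- `c₀ ≤ C` (compare the two rates at `ts`)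
  have hc₀C : c₀ ^ 2 ≤ C ^ 2 := by
    obtain ⟨x₀, hx₀⟩ := hler ts ⟨hts0, htsT⟩
    have h := hx₀.trans ((hlate ts le_rfl htsT).1 x₀)
    exact pow_le_pow_left₀ hc₀.le (le_of_mul_le_mul_right h (Real.sqrt_pos.2 hν)) 2
  have hΘ : 0 < max c₂ 1 * C ^ 2 := mul_pos (lt_of_lt_of_le one_pos (le_max_right _ _)) (pow_pos hC 2)
  refine ⟨k, max c₂ 1 * C ^ 2, C₁ / c₀ ^ 2, 2 * C / c₀, c₀ ^ 2 / 2, c₀ ^ 2, C ^ 2, d₀ / 2, hkm, hk01,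
    fun t ht m hm0 hmk => hread t ht m hm0 hmk, hΘ, by positivity, by positivity, by positivity, by positivity, hc₀C,
    by positivity, ?_⟩
  intro m hm_lo hm_lt η hη L
  have hm0 : 0 ≤ m := by linarith [kStar_pos]
  have hmK : m < sInf udcSet := hm_lt
  -- parameters of the density call
  obtain ⟨η', hη'⟩ : ∃ η' : ℝ, η' = min η (d₀ / 2) := ⟨_, rfl⟩
  have hη'pos : 0 < η' := by rw [hη']; exact lt_min hη (by linarith)
  have hη'η : η' ≤ η := by rw [hη']; exact min_le_left _ _
  have hη'd : η' ≤ d₀ / 2 := by rw [hη']; exact min_le_right _ _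
  obtain ⟨B, hB⟩ : ∃ B : ℝ, B = η' * max L 0 + max cL 0 + 1 := ⟨_, rfl⟩
  obtain ⟨t, ht, hmass⟩ := hdens m hmK (1 - η') (by linarith) B ts ⟨hts0, htsT⟩
  have h1 : ts ≤ t := ht.1
  have htT : t < T := ht.2
  -- the log-length `ℓ`
  obtain ⟨ℓ, hℓ⟩ : ∃ ℓ : ℝ, ℓ = Real.log ((T - ts) / (T - t)) := ⟨_, rfl⟩
  have hℓ0 : 0 ≤ ℓ := by
    rw [hℓ]; exact Real.log_nonneg ((one_le_div (sub_pos.2 htT)).2 (by linarith))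
  have heff_le : (∫ τ in ts..t, Set.indicator {s : ℝ | m < k s} (fun _ => (1 : ℝ)) τ / (T - τ)) ≤ ℓ := by
    rw [hℓ]; exact vw_mass_le_log (measurableSet_lt measurable_const hkm) h1 htT
  rw [← hℓ] at hmass
  have hkey : B < η' * ℓ := by linarith
  -- `ts < t` and `L ≤ ℓ`
  have hℓpos : 0 < ℓ := by
    by_contra hn
    have : ℓ = 0 := le_antisymm (not_lt.1 hn) hℓ0
    rw [this, mul_zero] at hkey
    have : 0 < B := by rw [hB]; positivity
    linarith
  have htst : ts < t := by
    by_contra hn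
    have : t = ts := le_antisymm (not_lt.1 hn) h1
    rw [this, div_self (sub_pos.2 htsT).ne', Real.log_one] at hℓ
    linarith
  have hLℓ : L ≤ ℓ := by
    have h2 : η' * max L 0 < η' * ℓ := by
      have : 0 ≤ max cL 0 := le_max_right _ _
      linarith
    exact (le_max_left L 0).trans (lt_of_mul_lt_mul_left h2 hη'pos.le).le
  -- the inefficient log-mass
  have hineff : (∫ τ in ts..t, Set.indicator {σ : ℝ | k σ ≤ m} (fun _ => (1 : ℝ)) τ / (T - τ)) < η' * ℓ - B := by
    rw [vw_compl_mass_eq hkm h1 htT, ← hℓ]; linarith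
  refine ⟨ts, t, hts0, htst, htT, by rw [← hℓ]; exact hLℓ, ?_, S₀ ∩ {σ : ℝ | m < k σ} ∩ Set.Icc ts t,
    (hS₀m.inter (measurableSet_lt measurable_const hkm)).inter measurableSet_Icc, Set.inter_subset_right, ?_, ?_⟩
  · -- `≤ ηℓ`
    rw [← hℓ]
    have : 0 < B := by rw [hB]; positivity
    nlinarith [hineff, hη'η, hℓ0]
  · -- the locked efficient set has log-mass `≥ (d₀/2)ℓ`
    rw [← hℓ]
    have hS₀mass := hS₀d t ht
    rw [← hℓ] at hS₀mass
    have hi := vw_inter_mass_ge (m := m) hS₀m hkm h1 htT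
    have hcL : cL ≤ max cL 0 := le_max_left _ _
    have : η' * max L 0 ≥ 0 := mul_nonneg hη'pos.le (le_max_right _ _)
    nlinarith [hi, hS₀mass, hineff, hη'd, hℓ0]
  · -- the height package at each point of `S`
    rintro τ ⟨⟨hτS₀, hτk⟩, hτI⟩
    obtain ⟨hτIco, hτlock⟩ := hS₀sub hτS₀
    have hτT : τ < T := hτIco.2
    have hτ0 : 0 ≤ τ := hts0.trans hτIco.1
    refine ⟨hτk, ?_⟩
    exact vw_heightPackage hν hC hc₀ hτT
      (fun t' ht' x => (hlate t' (hτIco.1.trans ht'.1) ht'.2).1 x) (hlate τ hτIco.1 hτT).2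
      (hler τ ⟨hτ0, hτT⟩) hτlock hm0 (hread τ ⟨hτ0, hτT⟩ m hm0 hτk)

end Summit.NavierStokesRegularity.NavierStokesRegularity.Theorems.NearExtremalTransiencePerFlow.TransienceExit

end
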